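import Mathlib
import HarnessLib
import HarnessLib.Audit
import Summits.CriticalPhenomena.Statement
import Literature.Probability.Percolation.CardyFormula

/-!
Route: CardyLogModulus

CLOSED (retired) 2026-08-15T13:47:51Z by operator:999:1257524 — reason: not-a-thesis: assembly does not conclude the sub-problem Statement — note: D-0027 §2.1 audit (human 2026-08-15: routes that do not decide the summit are removed): the assembly concludes `LogCardy`, not the sub-problem statement; a NEW conforming route may be opened from the same idea (generated `closes : … → _root_.CardyFormulaZ2`).. The file is kept as the record of this route; refuted decls are indexed as negative knowledge (`ledger negatives`).

# Route CardyLogModulus — Cardy in the logarithm — the series law and DKKMO transport the π/3 strip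
rate to every thin bent strip (waypoint route, X necessary for Cardy)

WAYPOINT ROUTE, declared up front (same shape as route-ABC-LogUniformFermat): X does NOT imply
CardyFormulaZ2 and is not
claimed to; X is a NECESSARY consequence of the conjunct (support item NecessityFromCardy:
CardyFormulaZ2 → StripValue, and every
item below is downstream of Cardy), so a refutation of any item refutes the conjunct, and a proof of
X is "Cardy's formula at
logarithmic precision on bond-ℤ²" — the first statement in which a non-Möbius conformal invariant of
the DOMAIN (extremal length)
provably governs a ℤ² crossing quantity. Accordingly the Assembly concludes at X. Card realised:
log-cardy-extremal-length-series-law.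
X = LogCardy = (i) ∧ (ii). (i) LOG-CARDY FOR THIN BENT STRIPS: for every annular sector S(w,Θ) = {1
< |z| < 1+w, 0 < arg z < Θ},
0 < Θ ≤ π, crossed by an open path of S_δ ⊆ δℤ² (G02 `discreteCrossing`) from the radial side on arg
z = 0 to the radial side on
arg z = Θ (conformal modulus m = Θ/log(1+w)), −log P_δ · log(1+w)/Θ → π/3 as δ → 0⁺ then w → 0⁺
(limsup and liminf in δ): the
exponential cost of a long crossing is π/3 per unit of extremal length, whatever the bending. (ii)
LOG-CARDY FOR MERGING MARKS
(funnels): the half-plane one-arm probability of bond-ℤ² at p = 1/2 from the origin to distance m in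
the upper half-box decays as
m^(−1/3+o(1)) (π/3 per unit of the log-polar modulus (log m)/π). It suffices, for X, to show the
ranked cruxes: StripValue (the π/3
law for straight lattice strips = log-Cardy for rectangles), RotatedRectangleInvariance (DKKMO Cor.
1.3 in G02's discretisation) and
FunnelTransport (value-free: arm log-rate = strip rate); the transport from straight strips to bent
strips (SectorTransport) is the
card's series-law mechanism and is filed as support because it is provable now given rotation
invariance.
Lean: `(∀ Θ : ℝ, 0 < Θ → Θ ≤ Real.pi → ∀ ε : ℝ, 0 < ε → ∃ w₀ : ℝ, 0 < w₀ ∧ ∀ w : ℝ, 0 < w → w < w₀ →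
∃ δ₀ : ℝ, 0 < δ₀ ∧ ∀ δ : ℝ, 0 < δ → δ < δ₀ → |(-Real.log
(Literature.Probability.Percolation.discreteCrossingProb Literature.Probability.Percolation.half {z
: ℂ | 1 < ‖z‖ ∧ ‖z‖ < 1 + w ∧ 0 < Complex.arg z ∧ Complex.arg z < Θ} δ ((fun t : ℝ => (t : ℂ)) ''
Set.Icc 1 (1 + w)) ((fun t : ℝ => (t : ℂ) * Complex.exp (Θ * Complex.I)) '' Set.Icc 1 (1 + w)))) *
Real.log (1 + w) / Θ - Real.pi / 3| ≤ ε) ∧ (∀ ε : ℝ, 0 < ε → ∃ M₀ : ℕ, ∀ m : ℕ, M₀ ≤ m → |(-Real.log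
((Literature.Probability.Percolation.bondPercolation (Literature.Probability.LatticeModels.zdGraph
2) Literature.Probability.Percolation.half).real (Literature.Probability.Percolation.openCrossing {x
: Literature.Probability.LatticeModels.Site 2 | |x 0| ≤ (m : ℤ) ∧ 0 ≤ x 1 ∧ x 1 ≤ (m : ℤ)} ({0} :
Set (Literature.Probability.LatticeModels.Site 2)) {x : Literature.Probability.LatticeModels.Site 2
| (|x 0| = (m : ℤ) ∨ x 1 = (m : ℤ)) ∧ |x 0| ≤ (m : ℤ) ∧ 0 ≤ x 1 ∧ x 1 ≤ (m : ℤ)}))) / Real.log m - 1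
/ 3| ≤ ε)`

## Assembly
Pure ε-bookkeeping, checked sorry-free in the planner's Sketch.lean (an `example` deriving LogCardy
from the four hypotheses):
SectorTransport applied to RotatedRectangleInvariance gives the value-free envelope for sectors;
StripValue pins the envelope of
L(An,n)/A to π/3 ± ε for A ≥ A₁ and n ≥ N₁, so taking A = max(A₀,A₁) and the witnesses n ≥ N₁ of the
two envelope clauses gives
|f − π/3| ≤ 2ε, i.e. (i); the same argument with FunnelTransport gives |h(m) − π/3| ≤ 2ε, and
dividing by π (with the junk case
log m = 0 harmless) gives (ii). No percolation is used in the assembly.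

Rationale: WHY THIS LINE. Write L = −log P. Independence of disjoint regions gives the EXACT series law P(Q) ≤
∏ P(Q_j) for quads cut in series along the
crossing direction (L super-additive), FKG + RSW gluing gives L(Q) ≤ Σ L(Q_j) + O(#cuts)
(Grimmett1999 §11.7, Aizenman1997), so at
fixed mesh L is additive along series decompositions up to O(1) per cut — the percolation twin of
Grötzsch's additivity of extremal
length (Ahlfors, Conformal Invariants, Ch. 4); Fekete then makes the straight-strip rate well
defined and DKKMO2020Rotational Cor. 1.3
(q = 1) makes it direction-free, and cutting a thin annular sector into k congruent pieces
sandwiched between inscribed/circumscribed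
ROTATED rectangles of aspect A (chord geometry: relative aspect error O(A²w)) transports the strip
rate to the sector with relative
error O(A²w) + O(1/A) → 0: conformal invariance at log level, value-free, with the embedding
entering only through DKKMO — exactly
where Literature.Barriers.CriticalPhenomena.EmbeddingModulusUniqueness says it must. The VALUE π/3 =
π·h_(1,3) is the boundary
2-leg gap of the free TL(n = 1)/XXZ(Δ = −1/2) strip transfer matrix (Cardy1984 finite-size scaling,
CardyJPhysA1992, Cardy1998
eq. for n = 1 spanning cluster: lim_L ln P(1,k,L) ∼ −(π/3)k), the single most accessible integrable
datum, shared with card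
tl-spectral-kleban-zagier; the funnel half asks the same transport across scales and is the honest
open end (dilation input).
Areas imported: classical geometric function theory (extremal length, series law) as the organising
dictionary; large-deviation /
sub-additivity; integrable boundary CFT only for one number. Nearest published prior,
ChelkakDuminilCopinHongler2016 Thm 1.1 /
Chelkak's toolbox, bounds crossings by discrete extremal length with UNMATCHED constants; this line
matches them for thin strips.
No prior route of this sub-problem works in the exponential regime; the negatives index
(stmt-CriticalPhenomena-0772, SAW) is unrelated.

RANKED CRUXES. #0 LogCardy (target) — X = (i) log-Cardy for thin annular sectors S(w,Θ), 0 < Θ ≤ π: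
−log P_δ[radial side ↔ radial side in S_δ] · log(1+w)/Θ is within ε of π/3 for w < w₀(Θ,ε) and δ <
δ₀(w); ∧ (ii) the half-plane one-arm exponent of bond-ℤ² at 1/2 is 1/3: −log P[0 ↔ ∂⁺Λ_m in the
upper half-box]/log m → 1/3. (why it might fail: (ii) is the boundary one-arm exponent 1/3 on ℤ²,
open (known on 𝕋 only, LSW 2002 via SLE₆); (i) inherits StripValue; a log-periodic drift of the
strip rate c_n in n (card logperiodic-limitexists-hunt) would falsify both while leaving RSW
intact.) [CardyJPhysA1992, doi:10.1088/0305-4470/31/5/003, LawlerSchrammWernerEJP2002,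
KestenScalingCMP1987]
#2 StripValue (crux) — the π/3 law for straight lattice strips (log-Cardy for rectangles; card G4,
shared with tl-spectral-kleban-zagier rung 1): with L(m,n) = −log P_(1/2)[LR crossing of
[0,m]×[0,n]] (G02 `crossingProb half m n`), for every ε there is A₀ such that for every integer
aspect A ≥ A₀, |L(An,n)/A − π/3| ≤ ε for all large n. Equivalently n/ξ_n → π/3 for the strip
correlation length ξ_n of the one-spanning-cluster sector. [difficulty: open-problem] (why it might
fail: identifying the crossing rate with the h_(1,3)=1/3 gap of the free/free TL(n=1) transfer
matrix needs a boundary-state overlap/completeness argument, and rigorous Bethe-ansatz gap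
asymptotics for the open U_q(sl₂)-invariant XXZ chain at Δ=−1/2 are not in print (periodic chain:
Kozlowski2018).) [CardyJPhysA1992, doi:10.1088/0305-4470/31/5/003, Cardy1984,
doi:10.1016/0550-3213(84)90241-4, doi:10.1016/0550-3213(90)90122-T, Ziff1996, Aizenman1997,
KlebanZagier2003, Kozlowski2018]
#3 RotatedRectangleInvariance (crux) — rotation invariance of rectangle crossing probabilities in
G02's discretisation: for a, b > 0 and every angle θ, P_(1/2)[discreteCrossing of
e^(iθ)·((0,a)×(0,b)) between the images of the two vertical sides] − P_(1/2)[discreteCrossing of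
(0,a)×(0,b) between its vertical sides] → 0 as δ → 0⁺. FACT-DEPENDENT and filed as an explicit crux
for that reason: this is DKKMO2020Rotational Cor. 1.3 at q = 1 (Schramm–Smirnov quad crossings, C¹
domain irrelevant for product measure) plus the transfer to `discreteCrossing`; the printed theorem
is not yet a Literature fact (only the loop form `dkkmo_rotation_invariance`, Thm 1.2/1.4, is
vendored, unproved); a cite item is filed. [difficulty: L] (why it might fail: printed theorem
(DKKMO Cor. 1.3, q=1) for Schramm–Smirnov quad crossings; the transfer to G02's discreteCrossing
(largest component, closest-arc rule at the corners) needs δ-uniform continuity of crossing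
probabilities in the quad (3-arm bounds); the Lean debt is DKKMO itself.) [DKKMO2020Rotational,
arXiv:2012.11672, Tassion2024, SchrammSmirnov2011, Nolin2008]
#4 FunnelTransport (crux) — value-free funnel transport (card G5): the half-plane one-arm log-rate
per unit of log-polar modulus, h(m) = −log P[0 ↔ ∂⁺Λ_m in the upper half-box] / ((log m)/π), has,
for m large, all its values inside the ε-envelope of the strip rates L(An,n)/A over arbitrarily
large n (for every large integer aspect A): ∀N ∃n≥N h(m) ≤ L(An,n)/A + ε and ∀N ∃n≥N h(m) ≥
L(An,n)/A − ε. With StripValue it gives (ii): β₁⁺ = (π/3)/π = 1/3, i.e. c_strip = π·β₁⁺. [deps: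
StripValue] [difficulty: open-problem] (why it might fail: the log-polar pieces of a funnel live at
different scales, so the series law here compares strip rates at DIFFERENT lattice widths — a
dilation/LimitExists-type input the line does not have (ScaleCovarianceNotMoebius moral); may be as
hard as conformal invariance at log level.) [LawlerSchrammWernerEJP2002, KestenScalingCMP1987,
doi:10.1016/0550-3213(84)90241-4, arXiv:cond-mat/0401245, doi:10.1088/0305-4470/31/5/003]
#9 SectorTransport (support) — value-free LogCI for thin annular sectors (card G1+G2+G3, the
mechanism): assuming RotatedRectangleInvariance, for 0 < Θ ≤ π and every ε there is A₀ such that for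
A ≥ A₀, w < w₀(A) and δ < δ₀(w), the normalised sector rate f = −log P_δ(S(w,Θ)) · log(1+w)/Θ
satisfies ∀N ∃n≥N f ≤ L(An,n)/A + ε and ∀N ∃n≥N f ≥ L(An,n)/A − ε. Proof plan (provable now): cut S
into k = ⌈m/A⌉ congruent sub-sectors; lower bound on −log P by the exact product law over
transversally-circumscribing, longitudinally-inscribed rotated lattice rectangles (edge-disjoint),
upper bound by FKG gluing of inscribed rotated rectangles through radial crossings of aspect-3
overlap windows (rsw_half via axis-parallel rectangles poking through the annulus); chord geometry
gives aspects A(1 ∓ C A² w) at the pieces' OWN lattice widths ⌊w(1±η)/δ⌋, so only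
length-subadditivity at fixed width (StripSeriesLaw) and RSW upper bounds L(m,n) ≤ C(m/n+1) are
needed — no comparison across widths; finitely many angles per (A,w), so pointwise
RotatedRectangleInvariance suffices; the witnesses n are ⌊w(1±η)/δ⌋ → ∞. [difficulty: L]
[DKKMO2020Rotational, GrimmettPercolation1999, BollobasRiordan2006, ChelkakDuminilCopinHongler2016,
Aizenman1997]
#9 StripSeriesLaw (support) — the two exact inequalities behind Fekete for lattice strips at p =
1/2: for 1 ≤ n ≤ m₁, m₂, (series law, independence of the edge-disjoint boxes [0,m₁]×[0,n] and
[m₁+1,m₁+m₂+1]×[0,n]) P[LR(m₁+m₂+1,n)] ≤ P[LR(m₁,n)]·P[LR(m₂,n)], and (Harris–FKG gluing through a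
top-bottom crossing of the n×n overlap square, P[TB(n,n)] = P[LR(n,n)] ≥ P[LR(n+1,n)] = 1/2 by
`crossingProb_half_succ_self`, planarity `exists_mem_support_of_crossing`) P[LR(m₁,n)]·P[LR(m₂,n)] ≤
2·P[LR(m₁+m₂−n,n)]. [difficulty: provable-now] [GrimmettPercolation1999, BollobasRiordan2006,
Aizenman1997]
#9 NecessityFromCardy (support) — the waypoint is downstream of the conjunct: CardyFormulaZ2 →
StripValue. Plan: identify `discreteCrossing` of the axis-parallel rectangle (0,A)×(0,1) at mesh 1/n
with `lrCrossing (A n − 2) (n − 2)` (interior grid, closest-arc rule), absorb the index shift by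
aspect-continuity/sub-additivity, and use F(η) ∼ (3Γ(2/3)/Γ(1/3)²) η^(1/3) (η → 0, from the
definition of `cardyFunction`) together with the extremal-length estimate log(1/η_A) = πA + O(1) for
the cross-ratio η_A of the rectangle of aspect A (Grötzsch/length–area two-sided bound; needs
conformal invariance of extremal length, not the elliptic modulus). [difficulty: L]
[CardyJPhysA1992, doi:10.1090/chel/371, GrimmettPercolation1999]

TWO-LAYER PLAN. Foreseen glued splits (k ≤ 3, depth 1), none filed now: StripValue ⇐ RateIsGap (the
strip crossing rate n·lim_m L(m,n)/m equals
−n·log λ of the leading eigenvalue of the free/free TL(n=1) transfer matrix in the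
one-spanning-cluster sector; Perron–Frobenius +
boundary-state overlap) → GapAsymptotics (n·(−log λ) → π/3: Bethe ansatz for the open
U_q(sl₂)-invariant XXZ chain at Δ = −1/2,
Pasquier–Saleur; or FSZ/Razumov–Stroganov exact finite-size data) → StripValue.
RotatedRectangleInvariance ⇐ QuadContinuity
(δ-uniform continuity of `discreteCrossingProb` under ε-perturbation of a rectangle, from rsw_half +
half-plane 3-arm summability)
→ DKKMOCrossingFact (Cor. 1.3, q = 1, as a Literature named fact) → RotatedRectangleInvariance.
FunnelTransport ⇐
HalfAnnulusRateCovariance (log-level scale covariance of radial crossing rates of half-annuli of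
fixed ratio) → LogPolarSeries
(series law + RSW circuits in log-polar pieces) → FunnelTransport. SectorTransport, if a prover
wants it split: SectorLowerBound
(product law) → SectorUpperBound (gluing) → SectorTransport.

KILL CRITERIA. Every item is implied by CardyFormulaZ2 (NecessityFromCardy for StripValue; Cardy +
RSW quasi-multiplicativity for (ii) and for
FunnelTransport; DKKMO for RotatedRectangleInvariance), so a REFUTATION of StripValue,
FunnelTransport or LogCardy refutes the
conjunct itself — file it loudly as a summit-level negative (and hand the witness to card
logperiodic-limitexists-hunt); the route as
a set of statements dies only with CardyFormulaZ2. The LINE is closed `exhausted` if a grounder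
shows that SectorTransport's sandwich
secretly needs comparison of strip rates at different lattice widths (a dilation input) — the
planner's check says it does not
(pieces keep their own widths; only aspects move, handled by length-subadditivity), and this is the
one place to look first; it is
closed `superseded` by any route proving CardyFormulaZ2 or LimitExists + rotation⇒conformal upgrade.
RotatedRectangleInvariance
cannot fail short of an error in DKKMO; if its discretisation transfer fails for G02's closest-arc
rule at corners, pivot (i) to
rectangles with marks moved inside the sides (arcs strictly inside the radial segments), which
changes nothing at log level.

NOT DECOMPOSED YET. General tubes (images φ(R_m) of long rectangles with |φ''/φ'| ≤ ε per unit
conformal length: Koebe-distortion sandwich, lattice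
realisability of inscribed/circumscribed rotated rectangles at irrational angles) — the sector
family is the corner-free bent strip
with exact rotational congruence of pieces, so no Koebe is needed at open; the general-tube version
is a layer-2 strengthening of (i)
once SectorTransport lands. Wedge/corner funnels (rate π/(3θ) per log-scale in a lattice wedge of
opening θ; θ = π/2 gives the
2/3 corner exponent of arXiv:cond-mat/0401245 §5) — same dilation gap as FunnelTransport, not filed.
The prefactor (O(1) term
−log(2^(4/3)·3Γ(2/3)/Γ(1/3)²) of −log P for rectangles) and any fixed-η statement — invisible to the
series law by design. The
identification lemma discreteCrossing(rectangle) = lrCrossing (index shift 2) and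
translation/reflection invariance of crossingProb —
prover-level lemmas riding with --supports.

CHEAPEST FALSIFIER. The strip rate is one number per width: c_n = n·lim_m L(m,n)/m is the log of the
Perron eigenvalue of a sparse transfer matrix on
non-crossing connectivity states of n+1 sites with a marked spanning cluster (exact rational
arithmetic feasible for n ≤ 10–12);
Fekete's sandwich (StripSeriesLaw) certifies c_n ∈ [n·L(An,n)/(An+1), n·(L(An,n)+log 2)/(An−n)] from
finite boxes. If the sequence
c_n extrapolates (1/n corrections, Ziff1996 effective-length shift) to anything but π/3 = 1.04720
within 1 %, StripValue and hence
CardyFormulaZ2 are in doubt; if c_n oscillates log-periodically, LimitExists is. Not run this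
session (plancard seat, no kit budget in
the payload); Cardy1998/Ziff1992-type numerics in print agree with π/3 to the digits available.
Second falsifier, for the mechanism:
Monte-Carlo (multilevel splitting) decay rates of half-annulus sectors, w = 1/4…1/16, against
straight strips at equal modulus
π/log(1+w): equal normalised rates within 1 %?

NUMBERS. π/3 = 1.047198 (rate per unit aspect; CardyJPhysA1992: π_h(r) ∼ C e^(−πr/3), C =
2^(4/3)·3Γ(2/3)/Γ(1/3)² = 1.4264, e.g. π_h(2) =
0.1756); Cardy1998: lim_L ln P(n,k,L) ∼ −(2π/3) n(n−1/2) k for n spanning clusters of a strip of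
aspect k (n = 1: −(π/3)k;
rigorous two-sided e^(−αn²k) bounds: Aizenman1997); boundary spanning-cluster exponent x₁ = h_(1,3)
= 1/3 (Cardy1998 p. 3, Cardy
NPB 240); modulus of S(w,Θ) between its radial sides = Θ/log(1+w) (log map), of the half-annulus
funnel {1<|z|<m, Im z>0} between
its semicircles = (log m)/π; half-plane one-arm exponent 1/3 on 𝕋 (LawlerSchrammWernerEJP2002), open
on ℤ²; universal ℤ² inputs
available: rsw_half (proved, `rsw_half_holds`), crossingProb_half_succ_self (proved), planar duality
(proved), DKKMO Cor. 1.3 (print).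
Items at open: 8 (1 target, 3 cruxes, 3 support, 1 assembly).

DEFINITION REQUESTS. (1) CITE fact wanted (filed as a cite work item after open):
DKKMO2020Rotational Cor. 1.3 at q = 1 — rotation invariance of
Schramm–Smirnov quad-crossing probabilities for Bernoulli bond percolation on δℤ², uniformly over
quads in a bounded window and
angles; the vendored `Literature.Probability.Percolation.dkkmo_rotation_invariance` is the loop
(d_CN) form of Thm 1.2/1.4 and does
not directly give crossings. (2) DEFINITION wanted (Literature/Analysis/Complex or
RandomPlanarGeometry): extremal length /
conformal modulus of a Jordan quad between two opposite arcs, with conformal invariance, Grötzsch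
series additivity and the two-sided
comparison log(1/η) = π·λ + O(1) with Cardy's cross-ratio η of `ConformalRectangle` — used by
NecessityFromCardy and by the general-tube
strengthening; Mathlib has none (searched Grötzsch|extremalLength|conformalModulus: only the
length–area lemmas of
Literature/Analysis/Complex/AnnulusCrossing.lean). No new object is posited by the route; all
statements are over G02's
`crossingProb`, `discreteCrossingProb`, `openCrossing`, `bondPercolation (zdGraph 2) half` with
explicit sets.

Novelty: Searches (2026-08-15, this planner, on top of the card's audit by
refuter-novelty-audit-CriticalPhenomena-CardyFormulaZ2-9-0):
`lit search --hybrid "percolation crossing probability long strip exponential decay extremal length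
conformal modulus curved annulus
sector" --problem CriticalPhenomena` (15 local book hits, none specific: Lawler2005, Kesten1982,
Grimmett1999, BollobasRiordan2006);
`lit search --source crossref "extremal length crossing probabilities percolation topological
rectangles"` (15: ChelkakDuminilCopinHongler2016
= doi:10.1214/16-ejp3452, KohlerSchindlerTassion2023 doi:10.1215/00127094-2022-0015, LPPS1992
doi:10.1007/bf01049720, Ziff1996);
`lit search --source zbmath "crossing probability percolation strip"` (4: Cardy1998 =
doi:10.1088/0305-4470/31/5/003 READ pp. 2–4:
lim ln P(n,k,L) ∼ −(2π/3)n(n−1/2)k, x₁ = 1/3, Aizenman's halving heuristic); `lit search --source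
crossref "half-plane one-arm exponent
critical percolation square lattice 1/3"` (LawlerSchrammWernerEJP2002 only); `lit frontier
CriticalPhenomena --since 2021` (30 rows,
nothing in the exponential regime); `lit galaxy search "extremal length" --star pdf` (15: Chelkak
toolbox euclid.aop/1454423052,
Smirnov ICM 2006 — discrete extremal length as an RSW device with unmatched constants) and
`"incipient spanning clusters" --star all`
(20 rows: Henkel's finite-size-scaling monograph, Bollobás–Riordan; no transport statement);
arXiv:2012.11672 READ pp. 4–5 (Thm 1.2,
Cor. 1.3, Cor. 1.4) and arXiv:1312.7785  [refs: 10.1214/16-ejp3452, 10.1215/00127094-2022-0015, 10.1007/bf01049720, 10.1088/0305-4470/31/5/003, 2012.11672, 1312.7785, doi:10.1214/16-ejp3452, doi:10.1215/00127094-2022-0015, doi:10.1007/bf01049720, doi:10.1088/0305-4470/31/5/003, Lawler2005, Kesten1982, Grimmett1999, BollobasRiordan2006, ChelkakDuminilCopinHongler2016, KohlerSchindlerTassion2023, Ziff1996, LawlerSchrammWernerEJP2002, CardyJPhysA1]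

Barriers (technique_class: extremal-length transport; large-deviation; series-law): - technique_class: extremal-length transport; large-deviation; series-law
- Literature.Barriers.CriticalPhenomena.EmbeddingModulusUniqueness: respected and USED — every step
except RotatedRectangleInvariance is embedding-blind (product measure, FKG, RSW, sub-additivity,
chord geometry) and would run verbatim on a sheared lattice, returning direction-dependent rates
c(θ) and the extremal length of the SHEARED conformal structure, exactly as Beffara's Prop. 4
predicts; the isotropy enters only through DKKMO Cor. 1.3, filed as an explicit crux, so the line
does not pretend to derive rotation invariance from rescaling arguments.
- Literature.Barriers.CriticalPhenomena.SmirnovTriangularOnly: not in class — no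
discrete-holomorphic observable, no colour switching, no 2π/3 symmetry; the only lattice-specific
inputs are self-duality at 1/2 (crossingProb_half_succ_self, for the gluing constant) and DKKMO.
- Literature.Barriers.CriticalPhenomena.CoveringLatticeShift: not in class — no
site/covering-lattice rewriting and no interpolation in a mixed parameter.
- Literature.Barriers.CriticalPhenomena.FKParafermionicHalfCauchyRiemann: not in class — no
parafermionic observable or vertex relations are used; the value π/3 is asked of the transfer-matrix
spectrum (StripValue), not of a half-determined observable.
- Literature.Barriers.CriticalPhenomena.ScaleCovarianceNotMoebius: catalogued for
Ising3DConformalLimit, cited only for its moral — it bites FunnelTransport (transport across scales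
n

History (route lifecycle, newest last):
- 2026-08-15T13:47:51Z · CLOSED retired — not-a-thesis: assembly does not conclude the sub-problem Statement (operator:999:1257524)

sub-problem: CardyFormulaZ2 · status: closed(retired) · opened planner-plancard-CriticalPhenomena-CardyFormu-5944e3dd-0 2026-08-15T11:56:53Z · rev 0 · ledger route-CriticalPhenomena-CardyLogModulus
GENERATED by the gate from the ledger (D-0016/17). Provers cite these decls: `theorem foo : Summit.CriticalPhenomena.CardyFormulaZ2.Theses.CardyLogModulus.<Decl> := …` in Summits/CriticalPhenomena/CardyFormulaZ2/Theorems/<Name>.lean.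
-/

namespace Summit.CriticalPhenomena.CardyFormulaZ2.Theses.CardyLogModulus

open scoped BigOperators Topology Manifold Classical MeasureTheory ProbabilityTheory Matrix InnerProductSpace ComplexConjugate ContinuousMap
open Filter Set Function TopologicalSpace MeasureTheory

attribute [summit_statement] _root_.CardyFormulaZ2

/-- item stmt-CriticalPhenomena-6970 · target · rank 0 · closed · moot by None · by planner
why it might fail: (ii) is the boundary one-arm exponent 1/3 on ℤ², open (known on 𝕋 only, LSW 2002 via SLE₆); (i) inherits StripValue; a log-periodic drift of the strip rate c_n in n (card logperiodic-limitexists-hunt) would falsify both while leaving RSW intact.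
sources: CardyJPhysA1992, doi:10.1088/0305-4470/31/5/003, LawlerSchrammWernerEJP2002, KestenScalingCMP1987
[target] X = (i) log-Cardy for thin annular sectors S(w,Θ), 0 < Θ ≤ π: −log P_δ[radial side ↔ radial
side in S_δ] · log(1+w)/Θ is within ε of π/3 for w < w₀(Θ,ε) and δ < δ₀(w); ∧ (ii) the half-plane
one-arm exponent of bond-ℤ² at 1/2 is 1/3: −log P[0 ↔ ∂⁺Λ_m in the upper half-box]/log m → 1/3. -/
@[route_item "route-CriticalPhenomena-CardyLogModulus"]
def LogCardy : Prop :=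
  (∀ Θ : ℝ, 0 < Θ → Θ ≤ Real.pi → ∀ ε : ℝ, 0 < ε → ∃ w₀ : ℝ, 0 < w₀ ∧ ∀ w : ℝ, 0 < w → w < w₀ → ∃ δ₀ : ℝ, 0 < δ₀ ∧ ∀ δ : ℝ, 0 < δ → δ < δ₀ → |(-Real.log (Literature.Probability.Percolation.discreteCrossingProb Literature.Probability.Percolation.half {z : ℂ | 1 < ‖z‖ ∧ ‖z‖ < 1 + w ∧ 0 < Complex.arg z ∧ Complex.arg z < Θ} δ ((fun t : ℝ => (t : ℂ)) '' Set.Icc 1 (1 + w)) ((fun t : ℝ => (t : ℂ) * Complex.exp (Θ * Complex.I)) '' Set.Icc 1 (1 + w)))) * Real.log (1 + w) / Θ - Real.pi / 3| ≤ ε) ∧ (∀ ε : ℝ, 0 < ε → ∃ M₀ : ℕ, ∀ m : ℕ, M₀ ≤ m → |(-Real.log ((Literature.Probability.Percolation.bondPercolation (Literature.Probability.LatticeModels.zdGraph 2) Literature.Probability.Percolation.half).real (Literature.Probability.Percolation.openCrossing {x : Literature.Probability.LatticeModels.Site 2 | |x 0| ≤ (m : ℤ) ∧ 0 ≤ x 1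 ∧ x 1 ≤ (m : ℤ)} ({0} : Set (Literature.Probability.LatticeModels.Site 2)) {x : Literature.Probability.LatticeModels.Site 2 | (|x 0| = (m : ℤ) ∨ x 1 = (m : ℤ)) ∧ |x 0| ≤ (m : ℤ) ∧ 0 ≤ x 1 ∧ x 1 ≤ (m : ℤ)}))) / Real.log m - 1 / 3| ≤ ε)

/-- item stmt-CriticalPhenomena-6971 · crux · rank 2 · closed · moot by None · by planner
why it might fail: identifying the crossing rate with the h_(1,3)=1/3 gap of the free/free TL(n=1) transfer matrix needs a boundary-state overlap/completeness argument, and rigorous Bethe-ansatz gap asymptotics for the open U_q(sl₂)-invariant XXZ chain at Δ=−1/2 are not in print (periodic chain: Kozlowski2018).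
sources: CardyJPhysA1992, doi:10.1088/0305-4470/31/5/003, Cardy1984, doi:10.1016/0550-3213(84)90241-4, doi:10.1016/0550-3213(90)90122-T, Ziff1996
[crux] the π/3 law for straight lattice strips (log-Cardy for rectangles; card G4, shared with
tl-spectral-kleban-zagier rung 1): with L(m,n) = −log P_(1/2)[LR crossing of [0,m]×[0,n]] (G02
`crossingProb half m n`), for every ε there is A₀ such that for every integer aspect A ≥ A₀,
|L(An,n)/A − π/3| ≤ ε for all large n. Equivalently n/ξ_n → π/3 for the strip correlation length ξ_n
of the one-spanning-cluster sector. [difficulty: open-problem] -/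
@[route_item "route-CriticalPhenomena-CardyLogModulus"]
def StripValue : Prop :=
  ∀ ε : ℝ, 0 < ε → ∃ A₀ : ℕ, ∀ A : ℕ, A₀ ≤ A → ∃ N : ℕ, ∀ n : ℕ, N ≤ n → |(-Real.log (Literature.Probability.Percolation.crossingProb Literature.Probability.Percolation.half (A * n) n)) / (A : ℝ) - Real.pi / 3| ≤ ε

/-- item stmt-CriticalPhenomena-6972 · crux · rank 3 · closed · moot by None · by planner
why it might fail: printed theorem (DKKMO Cor. 1.3, q=1) for Schramm–Smirnov quad crossings; the transfer to G02's discreteCrossing (largest component, closest-arc rule at the corners) needs δ-uniform continuity of crossing probabilities in the quad (3-arm bounds); the Lean debt is DKKMO itself.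
sources: DKKMO2020Rotational, arXiv:2012.11672, Tassion2024, SchrammSmirnov2011, Nolin2008
[crux] rotation invariance of rectangle crossing probabilities in G02's discretisation: for a, b > 0
and every angle θ, P_(1/2)[discreteCrossing of e^(iθ)·((0,a)×(0,b)) between the images of the two
vertical sides] − P_(1/2)[discreteCrossing of (0,a)×(0,b) between its vertical sides] → 0 as δ → 0⁺.
FACT-DEPENDENT and filed as an explicit crux for that reason: this is DKKMO2020Rotational Cor. 1.3
at q = 1 (Schramm–Smirnov quad crossings, C¹ domain irrelevant for product measure) plus the
transfer to `discreteCrossing`; the printed theorem is not yet a Literature fact (only the loop form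
`dkkmo_rotation_invariance`, Thm 1.2/1.4, is vendored, unproved); a cite item is filed. [difficulty:
L] -/
@[route_item "route-CriticalPhenomena-CardyLogModulus"]
def RotatedRectangleInvariance : Prop :=
  ∀ a b : ℝ, 0 < a → 0 < b → ∀ θ : ℝ, Filter.Tendsto (fun δ : ℝ => Literature.Probability.Percolation.discreteCrossingProb Literature.Probability.Percolation.half ((fun z : ℂ => Complex.exp (θ * Complex.I) * z) '' {z : ℂ | 0 < z.re ∧ z.re < a ∧ 0 < z.im ∧ z.im < b}) δ ((fun z : ℂ => Complex.exp (θ * Complex.I) * z) '' {z : ℂ | z.re = 0 ∧ 0 ≤ z.im ∧ z.im ≤ b}) ((fun z : ℂ => Complex.exp (θ * Complex.I) * z) '' {z : ℂ | z.re = a ∧ 0 ≤ z.im ∧ z.im ≤ b}) - Literature.Probability.Percolation.discreteCrossingProb Literature.Probability.Percolation.half {z : ℂ | 0 < z.re ∧ z.re < a ∧ 0 < z.im ∧ z.im < b} δ {z : ℂ | z.re = 0 ∧ 0 ≤ z.im ∧ z.im ≤ b} {z : ℂ | z.re = a ∧ 0 ≤ z.im ∧ z.im ≤ b}) (nhdsWithin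 0 (Set.Ioi 0)) (nhds 0)

/-- item stmt-CriticalPhenomena-6973 · crux · rank 4 · closed · moot by None · by planner
why it might fail: the log-polar pieces of a funnel live at different scales, so the series law here compares strip rates at DIFFERENT lattice widths — a dilation/LimitExists-type input the line does not have (ScaleCovarianceNotMoebius moral); may be as hard as conformal invariance at log level.
sources: LawlerSchrammWernerEJP2002, KestenScalingCMP1987, doi:10.1016/0550-3213(84)90241-4, arXiv:cond-mat/0401245, doi:10.1088/0305-4470/31/5/003
[crux] value-free funnel transport (card G5): the half-plane one-arm log-rate per unit of log-polar
modulus, h(m) = −log P[0 ↔ ∂⁺Λ_m in the upper half-box] / ((log m)/π), has, for m large, all its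
values inside the ε-envelope of the strip rates L(An,n)/A over arbitrarily large n (for every large
integer aspect A): ∀N ∃n≥N h(m) ≤ L(An,n)/A + ε and ∀N ∃n≥N h(m) ≥ L(An,n)/A − ε. With StripValue it
gives (ii): β₁⁺ = (π/3)/π = 1/3, i.e. c_strip = π·β₁⁺. [deps: StripValue] [difficulty: open-problem] -/
@[route_item "route-CriticalPhenomena-CardyLogModulus"]
def FunnelTransport : Prop :=
  ∀ ε : ℝ, 0 < ε → ∃ A₀ : ℕ, ∀ A : ℕ, A₀ ≤ A → ∃ M₀ : ℕ, ∀ m : ℕ, M₀ ≤ m → (∀ N : ℕ, ∃ n : ℕ, N ≤ n ∧ (-Real.log ((Literature.Probability.Percolation.bondPercolation (Literature.Probability.LatticeModels.zdGraph 2) Literature.Probability.Percolation.half).real (Literature.Probability.Percolation.openCrossing {x : Literature.Probability.LatticeModels.Site 2 | |x 0| ≤ (m : ℤ) ∧ 0 ≤ x 1 ∧ x 1 ≤ (m : ℤ)} ({0} : Set (Literature.Probability.LatticeModels.Site 2)) {x : Literature.Probability.LatticeModels.Site 2 | (|x 0| = (m : ℤ) ∨ x 1 = (m : ℤ)) ∧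 |x 0| ≤ (m : ℤ) ∧ 0 ≤ x 1 ∧ x 1 ≤ (m : ℤ)}))) / (Real.log m / Real.pi) ≤ (-Real.log (Literature.Probability.Percolation.crossingProb Literature.Probability.Percolation.half (A * n) n)) / (A : ℝ) + ε) ∧ (∀ N : ℕ, ∃ n : ℕ, N ≤ n ∧ (-Real.log (Literature.Probability.Percolation.crossingProb Literature.Probability.Percolation.half (A * n) n)) / (A : ℝ) - ε ≤ (-Real.log ((Literature.Probability.Percolation.bondPercolation (Literature.Probability.LatticeModels.zdGraph 2) Literature.Probability.Percolation.half).real (Literature.Probability.Percolation.openCrossing {x : Literature.Probability.LatticeModels.Site 2 | |x 0| ≤ (m : ℤ) ∧ 0 ≤ x 1 ∧ x 1 ≤ (m : ℤ)} ({0} : Set (Literature.Probability.LatticeModels.Site 2)) {x : Literature.Probability.LatticeModels.Site 2 | (|x 0| = (m : ℤ) ∨ x 1 = (m : ℤ)) ∧ |x 0| ≤ (m : ℤ) ∧ 0 ≤ x 1 ∧ x 1 ≤ (m : ℤ)}))) / (Real.log m / Real.pi))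

/-- item stmt-CriticalPhenomena-6974 · support · rank 9 · closed · moot by None · by planner
sources: DKKMO2020Rotational, GrimmettPercolation1999, BollobasRiordan2006, ChelkakDuminilCopinHongler2016, Aizenman1997
[support] value-free LogCI for thin annular sectors (card G1+G2+G3, the mechanism): assuming
RotatedRectangleInvariance, for 0 < Θ ≤ π and every ε there is A₀ such that for A ≥ A₀, w < w₀(A)
and δ < δ₀(w), the normalised sector rate f = −log P_δ(S(w,Θ)) · log(1+w)/Θ satisfies ∀N ∃n≥N f ≤
L(An,n)/A + ε and ∀N ∃n≥N f ≥ L(An,n)/A − ε. Proof plan (provable now): cut S into k = ⌈m/A⌉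
congruent sub-sectors; lower bound on −log P by the exact product law over
transversally-circumscribing, longitudinally-inscribed rotated lattice rectangles (edge-disjoint),
upper bound by FKG gluing of inscribed rotated rectangles through radial crossings of aspect-3
overlap windows (rsw_half via axis-parallel rectangles poking through the annulus); chord geometry
gives aspects A(1 ∓ C A² w) at the pieces' OWN lattice widths ⌊w(1±η)/δ⌋, so only
length-subadditivity at fixed width (StripSeriesLaw) and RSW upper bounds L(m,n) ≤ C(m/n+1) are
needed — no comparison across widths; finitely many angles per (A,w), so pointwise
RotatedRectangleInvariance suffices; the witnesses n are ⌊w(1±η)/δ⌋ → ∞. [difficulty: L] -/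
@[route_item "route-CriticalPhenomena-CardyLogModulus"]
def SectorTransport : Prop :=
  RotatedRectangleInvariance → ∀ Θ : ℝ, 0 < Θ → Θ ≤ Real.pi → ∀ ε : ℝ, 0 < ε → ∃ A₀ : ℕ, ∀ A : ℕ, A₀ ≤ A → ∃ w₀ : ℝ, 0 < w₀ ∧ ∀ w : ℝ, 0 < w → w < w₀ → ∃ δ₀ : ℝ, 0 < δ₀ ∧ ∀ δ : ℝ, 0 < δ → δ < δ₀ → (∀ N : ℕ, ∃ n : ℕ, N ≤ n ∧ (-Real.log (Literature.Probability.Percolation.discreteCrossingProb Literature.Probability.Percolation.half {z : ℂ | 1 < ‖z‖ ∧ ‖z‖ < 1 + w ∧ 0 < Complex.arg z ∧ Complex.arg z < Θ} δ ((fun t : ℝ => (t : ℂ)) '' Set.Icc 1 (1 + w)) ((fun t : ℝ => (t : ℂ) * Complex.exp (Θ * Complex.I)) '' Set.Icc 1 (1 + w)))) * Real.log (1 + w) / Θ ≤ (-Real.log (Literature.Probability.Percolation.crossingProb Literature.Probability.Percolation.half (A * n) n)) / (A : ℝ) + ε) ∧ (∀ N : ℕ, ∃ n : ℕ, N ≤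 n ∧ (-Real.log (Literature.Probability.Percolation.crossingProb Literature.Probability.Percolation.half (A * n) n)) / (A : ℝ) - ε ≤ (-Real.log (Literature.Probability.Percolation.discreteCrossingProb Literature.Probability.Percolation.half {z : ℂ | 1 < ‖z‖ ∧ ‖z‖ < 1 + w ∧ 0 < Complex.arg z ∧ Complex.arg z < Θ} δ ((fun t : ℝ => (t : ℂ)) '' Set.Icc 1 (1 + w)) ((fun t : ℝ => (t : ℂ) * Complex.exp (Θ * Complex.I)) '' Set.Icc 1 (1 + w)))) * Real.log (1 + w) / Θ)

/-- item stmt-CriticalPhenomena-6975 · support · rank 9 · closed · moot by None · by planner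
sources: GrimmettPercolation1999, BollobasRiordan2006, Aizenman1997
[support] the two exact inequalities behind Fekete for lattice strips at p = 1/2: for 1 ≤ n ≤ m₁,
m₂, (series law, independence of the edge-disjoint boxes [0,m₁]×[0,n] and [m₁+1,m₁+m₂+1]×[0,n])
P[LR(m₁+m₂+1,n)] ≤ P[LR(m₁,n)]·P[LR(m₂,n)], and (Harris–FKG gluing through a top-bottom crossing of
the n×n overlap square, P[TB(n,n)] = P[LR(n,n)] ≥ P[LR(n+1,n)] = 1/2 by
`crossingProb_half_succ_self`, planarity `exists_mem_support_of_crossing`) P[LR(m₁,n)]·P[LR(m₂,n)] ≤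
2·P[LR(m₁+m₂−n,n)]. [difficulty: provable-now] -/
@[route_item "route-CriticalPhenomena-CardyLogModulus"]
def StripSeriesLaw : Prop :=
  ∀ n m₁ m₂ : ℕ, 1 ≤ n → n ≤ m₁ → n ≤ m₂ → Literature.Probability.Percolation.crossingProb Literature.Probability.Percolation.half (m₁ + m₂ + 1) n ≤ Literature.Probability.Percolation.crossingProb Literature.Probability.Percolation.half m₁ n * Literature.Probability.Percolation.crossingProb Literature.Probability.Percolation.half m₂ n ∧ Literature.Probability.Percolation.crossingProb Literature.Probability.Percolation.half m₁ n * Literature.Probability.Percolation.crossingProb Literature.Probability.Percolation.half m₂ n ≤ 2 * Literature.Probability.Percolation.crossingProb Literature.Probability.Percolation.half (m₁ + m₂ - n) n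

/-- item stmt-CriticalPhenomena-6976 · support · rank 9 · closed · moot by None · by planner
sources: CardyJPhysA1992, doi:10.1090/chel/371, GrimmettPercolation1999
[support] the waypoint is downstream of the conjunct: CardyFormulaZ2 → StripValue. Plan: identify
`discreteCrossing` of the axis-parallel rectangle (0,A)×(0,1) at mesh 1/n with `lrCrossing (A n − 2)
(n − 2)` (interior grid, closest-arc rule), absorb the index shift by
aspect-continuity/sub-additivity, and use F(η) ∼ (3Γ(2/3)/Γ(1/3)²) η^(1/3) (η → 0, from the
definition of `cardyFunction`) together with the extremal-length estimate log(1/η_A) = πA + O(1) for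
the cross-ratio η_A of the rectangle of aspect A (Grötzsch/length–area two-sided bound; needs
conformal invariance of extremal length, not the elliptic modulus). [difficulty: L] -/
@[route_item "route-CriticalPhenomena-CardyLogModulus"]
def NecessityFromCardy : Prop :=
  CardyFormulaZ2 → StripValue

/-- item stmt-CriticalPhenomena-6977 · assembly · rank 1 · closed · moot by None · by planner
sources: CardyJPhysA1992, DKKMO2020Rotational
[assembly] StripValue → RotatedRectangleInvariance → SectorTransport → FunnelTransport → LogCardy. -/
@[route_item "route-CriticalPhenomena-CardyLogModulus"]
def Assembly : Prop :=
  StripValue → RotatedRectangleInvariance → SectorTransport → FunnelTransport → LogCardy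

end Summit.CriticalPhenomena.CardyFormulaZ2.Theses.CardyLogModulus
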